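import Literature.Algebra.Homology.CharpolyHomologyShortExact
import Literature.Algebra.Homology.LefschetzNumberShift
import HarnessLib

/-!
# Characteristic polynomials on cohomology under the shift: `∏ᶠ χ(Hᵖ(φ⟦n⟧))^{(−1)ᵖ} = (∏ᶠ χ(H^q(φ))^{(−1)^q})^{(−1)ⁿ}`

Layer `Literature/Algebra/Homology` (pure linear algebra over Mathlib; proved theorems only, 0 definitions, 0 named facts, no instances,
no notation). The charpoly member under rows `EulerCharacteristicShift` (`χ`) and `LefschetzNumberShift` (`Λ`): for a cochain complex `C` of
vector spaces over a field `K`, an endomorphism `φ` and `n : ℤ`, Mathlib's natural isomorphism `CochainComplex.ShiftSequence.shiftIso`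
conjugates `Hᵖ(φ⟦n⟧)` to `Hᵖ⁺ⁿ(φ)` (row `LefschetzNumberShift`'s argument), hence

* `charpoly_homologyMap_shift` — `χ(Hᵖ(φ⟦n⟧)) = χ(Hᵖ⁺ⁿ(φ))` (`LinearEquiv.charpoly_conj`);
* `finprod_zpow_negOnePow_comp_add_right` — the multiplicative sign re-indexing in a commutative group;
* **`finprod_charpoly_homologyMap_shift`** — `∏ᶠ p, ↑χ(Hᵖ(φ⟦n⟧'))^{(−1)ᵖ} = (∏ᶠ q, ↑χ(H^q(φ))^{(−1)^q})^{(−1)ⁿ}` in `RatFunc K` (finite-dimensional,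
  finitely supported cohomology).

Rows `EulerCharacteristicShift` / `LefschetzNumberShift` (its `natDegree` / `nextCoeff` shadows) are NOT restated. Library only (cell
`pub-hodge-ring2`, count-neutral); proves nothing about any crux, route or conjecture.

## References

* S. Lang, *Algebra* (2002), Ch. XX §3 (Euler–Poincaré maps). [Lang2002]
* A. Hatcher, *Algebraic Topology* (2002), §2.C. [HatcherAT2002]
-/

open CategoryTheory CategoryTheory.Limits Polynomial

universe v u

namespace Literature.Algebra.Homology.HopfTrace

/-- **Multiplicative sign re-indexing**: `∏ᶠ p, g (p + n)^{(−1)ᵖ} = (∏ᶠ q, (g q)^{(−1)^q})^{(−1)ⁿ}` in a commutative group, for `g` with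
finite support. [cite: Lang2002, Ch. XX §3] -/
theorem finprod_zpow_negOnePow_comp_add_right {G : Type*} [CommGroup G] (g : ℤ → G) (hg : g.HasFiniteMulSupport) (n : ℤ) :
    ∏ᶠ p : ℤ, g (p + n) ^ ((p.negOnePow : ℤ)) = (∏ᶠ q : ℤ, g q ^ ((q.negOnePow : ℤ))) ^ ((n.negOnePow : ℤ)) := by
  have hs : (fun q : ℤ => g q ^ ((q.negOnePow : ℤ))).HasFiniteMulSupport := hg.subset fun q hq => by
    simp only [Function.mem_mulSupport, ne_eq] at hq ⊢
    exact fun h => hq (by rw [h, one_zpow])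
  rw [show (∏ᶠ q : ℤ, g q ^ ((q.negOnePow : ℤ))) ^ ((n.negOnePow : ℤ)) =
      (zpowGroupHom (n.negOnePow : ℤ) : G →* G) (∏ᶠ q : ℤ, g q ^ ((q.negOnePow : ℤ))) from rfl, MonoidHom.map_finprod _ hs,
    ← finprod_comp_equiv (Equiv.addRight n) (f := fun q => (zpowGroupHom (n.negOnePow : ℤ) : G →* G) (g q ^ ((q.negOnePow : ℤ))))]
  refine finprod_congr fun p => ?_
  rw [zpowGroupHom_apply, Equiv.coe_addRight, ← zpow_mul, Int.negOnePow_add, Units.val_mul, mul_assoc, ← Units.val_mul,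
    Int.units_mul_self, Units.val_one, mul_one]

variable {K : Type u} [Field K] (C : CochainComplex (ModuleCat.{v} K) ℤ) (φ : C ⟶ C) (n : ℤ)

/-- `Hᵖ(C⟦n⟧)` is finite-dimensional when `Hᵖ⁺ⁿ(C)` is. [cite: HatcherAT2002, §2.C] -/
theorem moduleFinite_homology_shift (p : ℤ) [Module.Finite K (C.homology (p + n))] :
    Module.Finite K (((CategoryTheory.shiftFunctor _ n).obj C).homology p) :=
  haveI : Module.Finite K ((HomologicalComplex.homologyFunctor (ModuleCat.{v} K) (ComplexShape.up ℤ) (p + n)).obj C) :=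
    inferInstanceAs (Module.Finite K (C.homology (p + n)))
  Module.Finite.equiv ((CochainComplex.ShiftSequence.shiftIso (ModuleCat.{v} K) n p (p + n) (add_comm _ _)).app C).toLinearEquiv.symm

/-- **`χ(Hᵖ(φ⟦n⟧)) = χ(Hᵖ⁺ⁿ(φ))`** (conjugation along Mathlib's `ShiftSequence.shiftIso`). [cite: HatcherAT2002, §2.C] -/
theorem charpoly_homologyMap_shift (p : ℤ) [Module.Finite K (C.homology (p + n))]
    [Module.Finite K (((CategoryTheory.shiftFunctor _ n).obj C).homology p)] :
    (HomologicalComplex.homologyMap ((CategoryTheory.shiftFunctor _ n).map φ) p).hom.charpoly =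
      (HomologicalComplex.homologyMap φ (p + n)).hom.charpoly := by
  let e : ((CategoryTheory.shiftFunctor _ n).obj C).homology p ≅ C.homology (p + n) :=
    (CochainComplex.ShiftSequence.shiftIso (ModuleCat.{v} K) n p (p + n) (add_comm _ _)).app C
  have nat : HomologicalComplex.homologyMap ((CategoryTheory.shiftFunctor _ n).map φ) p ≫ e.hom =
      e.hom ≫ HomologicalComplex.homologyMap φ (p + n) :=
    (CochainComplex.ShiftSequence.shiftIso (ModuleCat.{v} K) n p (p + n) (add_comm _ _)).hom.naturality φ
  have hconj : e.toLinearEquiv.conj (HomologicalComplex.homologyMap ((CategoryTheory.shiftFunctor _ n).map φ) p).hom =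
      (HomologicalComplex.homologyMap φ (p + n)).hom := by
    refine LinearMap.ext fun y => ?_
    obtain ⟨x, rfl⟩ := e.toLinearEquiv.surjective y
    rw [LinearEquiv.conj_apply_apply, LinearEquiv.symm_apply_apply]
    have hx := congrArg (fun g => g.hom x) nat
    simp only [ModuleCat.hom_comp, LinearMap.comp_apply] at hx
    exact hx
  rw [← hconj, LinearEquiv.charpoly_conj]

/-- **`∏ᶠ p, χ(Hᵖ(φ⟦n⟧'))^{(−1)ᵖ} = (∏ᶠ q, χ(H^q(φ))^{(−1)^q})^{(−1)ⁿ}`** in `RatFunc K`, for finite-dimensional cohomology in finitely many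
degrees (the charpoly twin of row `LefschetzNumberShift`'s `lefschetzNumber_shift`). [cite: Lang2002, Ch. XX §3] [cite: HatcherAT2002, §2.C] -/
theorem finprod_charpoly_homologyMap_shift [∀ q, Module.Finite K (C.homology q)]
    [∀ p, Module.Finite K (((CategoryTheory.shiftFunctor _ n).obj C).homology p)]
    (hH : (GradedObject.finrankSupport fun q => C.homology q).Finite) :
    ∏ᶠ p, algebraMap K[X] (RatFunc K)
        (HomologicalComplex.homologyMap ((CategoryTheory.shiftFunctor _ n).map φ) p).hom.charpoly ^ ((p.negOnePow : ℤ)) =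
      (∏ᶠ q, algebraMap K[X] (RatFunc K) (HomologicalComplex.homologyMap φ q).hom.charpoly ^ ((q.negOnePow : ℤ))) ^
        ((n.negOnePow : ℤ)) := by
  have hρ : ∀ {M : Type v} [AddCommGroup M] [Module K M] [Module.Finite K M] (f : M →ₗ[K] M),
      algebraMap K[X] (RatFunc K) f.charpoly ≠ 0 := fun f =>
    (map_ne_zero_iff _ (RatFunc.algebraMap_injective K)).2 f.charpoly_monic.ne_zero
  let U : ℤ → (RatFunc K)ˣ := fun q => Units.mk0 _ (hρ (HomologicalComplex.homologyMap φ q).hom)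
  have hU : (U).HasFiniteMulSupport := hH.subset fun q hq => by
    by_contra hq'
    haveI : Subsingleton (C.homology q) := Module.finrank_zero_iff.1 (by simpa [GradedObject.finrankSupport] using hq')
    exact hq (Units.ext (by simp only [U, Units.val_mk0, Units.val_one, charpoly_eq_one_of_subsingleton, map_one]))
  have hU' : (fun p : ℤ => U (p + n)).HasFiniteMulSupport := hU.preimage (add_left_injective n).injOn
  have h := congrArg (fun x : (RatFunc K)ˣ => (x : RatFunc K)) (finprod_zpow_negOnePow_comp_add_right U hU n)
  simp only [Units.val_zpow_eq_zpow_val, coe_finprod_units_zpow _ _ hU, coe_finprod_units_zpow _ _ hU', U, Units.val_mk0] at h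
  rw [← h]
  exact finprod_congr fun p => by rw [charpoly_homologyMap_shift C φ n p]

end Literature.Algebra.Homology.HopfTrace
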